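import Summits.QuantumFields.YangMills.Theorems.AllWindowsColdBoxBoxHighLineConnectedFourPointPair
import Summits.QuantumFields.YangMills.Theorems.AllWindowsColdBoxBoxHighLinePlaquettePairSums

/-!
# `ConnectedFourPoint`, cubic pair — the SIZE: `|κ₄,₀(L₀, L_T, P, P)| ≤ C·B²·(1+log H)⁷/β³` (U5-BLOCKERS L3 / ASSEMBLY-U5 §3 `f″(0)`)

LEAD seat `ym-line-sfw-p2` (g78), cell ym-idea-1; U5 prep, helper-grade.  The connected four-point term of `f″(0) = κ₄,₀(c₀, c_T; U, U)` that Cauchy–Schwarz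
cannot afford (blocker B3, `H¹²/β`) is the CUBIC PAIR against the Gaussian parts of the two plaquette observables:

★★ `abs_cum4_linCurvSq_cubicPair_le` — there is `C ≥ 0` (from ✓S3b's propagator constant and the lattice-sum constants) such that for all `H ≥ 1`, `β > 0`, `B`,
coefficient families `|T_p ijk| ≤ B` and base points `x₀, x_T`, with `E₀ = gaussAvg β H`, `L_z = linCurvSq H (plaq12At z)`, `L̃ = L − E₀L`,
`P = β·Σ_{p touching the box} tripleForm (T p) (plaqVar_p)`:

  `|E₀[L̃₀ · L̃_T · P²] − E₀[L̃₀ · L̃_T] · E₀[P²]| ≤ C · B² · (1 + log H)⁷ / β³`.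

(`= κ₄(L̃₀, L̃_T, P, P)` since `E₀[L̃P] = 0` by parity.)  Route: linearity of `E₀` through ✓`gaussAvg_eq_integral_pi` (`integrable_transfer_pairTerm`), the per-pair
estimate ✓`abs_connected_linCurvSq_tripleForm_pair_le` with all six propagator bounds from ✓`cross_propagator_le` (`K = (2β)⁻¹·9C(1+log H)`), and the plaquette
double sums ✓`PlaqSums.plaquettePairSums`: `Σ_{c,c',p,p'} ≤ 9·(384B)²·K⁵·774144·C'·(1+log H)²`, `β²·K⁵ = 9⁵C⁵(1+log H)⁵/(32β³)`.
RELATIVE to the main term `(3/2)K₀T²/β² ≥ c·H⁻⁸β⁻²` on the bulk window this is `H⁸·(1+log H)⁷/β → 0` iff `8θ < 1` — inside U5's `θ < 1/10`, replacing B3's `12θ < 1`.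

Tree only + Mathlib; no definitions; standard axioms.  HONEST LABEL: one brick (the L3c size) of the RECORDED lift L3 of the NEXT rung U5 (⟨stmt-QuantumFields-24336⟩, UNSTAFFED; the
D′-truncation transfer, the `tripleForm` → `c^{odd}` remainder and the other `κ₄,₀` pieces are NOT here); ⟨24004⟩ ⟨24336⟩ and this seat's crux ⟨stmt-QuantumFields-22884⟩ remain OPEN;
route AllWindowsColdBox is DRAFT; no crux, rung or summit is proved; **the Yang–Mills mass gap is NOT proved by this file; no summit is proved by a line.**
-/

set_option autoImplicit false

noncomputable section

open MeasureTheory ProbabilityTheory Matrix Finset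
open scoped Kronecker
open Literature.Probability.LatticeModels (Site)
open Literature.MathematicalPhysics.QuantumLattice (ZdPlaquette plaquettesTouching)
open Literature.MathematicalPhysics.QuantumFieldTheory.AxialGauge (boxEdges)
open Summit.QuantumFields.YangMills.Theorems.WeakCouplingRates (plaq12At)

namespace Summit.QuantumFields.YangMills.Theorems.AllWindowsColdBoxBoxHighLine

namespace EdgeChartGaussian

open LaplaceSandwich (flatten flatten_apply flatten_symm_apply)
open GaussianChartWick WickTwoPairs Literature.Probability.Distributions.GaussianWick

/-! ## §1 Every summand is a polynomial in Gaussian legs, hence integrable under `P_β` -/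

/-- ★ Integrability under `P_β` of the three transferred integrands of the per-pair estimate (for ANY constants `sA`, `sB`): given the transfer data
(`Ψ`, `hat`, the legs process `X`) with coordinates and curvatures of `Ψ w` as legs. -/
theorem integrable_transfer_pairTerm {H n : ℕ} {μP : Measure (Fin n → ℝ)} {X : (Fin n → ℝ) → (Fin n → ℝ) → ℝ}
    (hX : IsGaussianProcess X μP) (Ψ : (Fin n → ℝ) → (LandauFree H → E3)) (hat : (LandauFree H × Fin 3 → ℝ) → (Fin n → ℝ))
    (hΨc : ∀ w (e : LandauFree H) (c : Fin 3), (Ψ w) e c = X (hat (Pi.single (e, c) 1)) w)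
    (hΨA : ∀ w (z : Site 4) (c : Fin 3), linCurv H (plaq12At z) (Ψ w) c =
      X (hat (fun q : LandauFree H × Fin 3 => if q.2 = c then landauCoeff H (plaq12At z) q.1 else 0)) w)
    {B : ℝ} (T T' : Fin 4 → Fin 4 → Fin 4 → ℝ) (hT : ∀ i j k, |T i j k| ≤ B) (hT' : ∀ i j k, |T' i j k| ≤ B)
    (x y : Site 4) (μ ν μ' ν' : Fin 4) (x₀ xT : Site 4) (c₀ cT : Fin 3) (sA sB : ℝ) :
    Integrable (fun w => (linCurv H (plaq12At x₀) (Ψ w) c₀ ^ 2 - sA) * (linCurv H (plaq12At xT) (Ψ w) cT ^ 2 - sB) *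
        (tripleForm T (plaqVar H x μ ν (Ψ w)) * tripleForm T' (plaqVar H y μ' ν' (Ψ w)))) μP ∧
      Integrable (fun w => (linCurv H (plaq12At x₀) (Ψ w) c₀ ^ 2 - sA) * (linCurv H (plaq12At xT) (Ψ w) cT ^ 2 - sB)) μP ∧
      Integrable (fun w => tripleForm T (plaqVar H x μ ν (Ψ w)) * tripleForm T' (plaqVar H y μ' ν' (Ψ w))) μP := by
  classical
  have hPm : IsProbabilityMeasure μP := hX.isProbabilityMeasure
  obtain ⟨KA, _, cA, legA, -, -, -, hexpA⟩ := tripleForm_plaqVar_expansion H x μ ν T hT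
  obtain ⟨KB, _, cB, legB, -, -, -, hexpB⟩ := tripleForm_plaqVar_expansion H y μ' ν' T' hT'
  obtain ⟨ℓA, hℓA⟩ : ∃ ℓ, ℓ = hat (fun q : LandauFree H × Fin 3 => if q.2 = c₀ then landauCoeff H (plaq12At x₀) q.1 else 0) := ⟨_, rfl⟩
  obtain ⟨ℓB, hℓB⟩ : ∃ ℓ, ℓ = hat (fun q : LandauFree H × Fin 3 => if q.2 = cT then landauCoeff H (plaq12At xT) q.1 else 0) := ⟨_, rfl⟩
  have hW : ∀ w, (linCurv H (plaq12At x₀) (Ψ w) c₀ ^ 2 - sA) * (linCurv H (plaq12At xT) (Ψ w) cT ^ 2 - sB) =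
      (X ℓA w * X ℓA w - sA) * (X ℓB w * X ℓB w - sB) := by
    intro w; rw [hΨA, hΨA, ← hℓA, ← hℓB, pow_two, pow_two]
  have hV : ∀ w, tripleForm T (plaqVar H x μ ν (Ψ w)) * tripleForm T' (plaqVar H y μ' ν' (Ψ w)) =
      ∑ k, ∑ k', cA k * cB k' * ∏ j : Fin 3 ⊕ Fin 3,
        X (Sum.elim (fun s => hat (Pi.single (legA k s) 1)) (fun s => hat (Pi.single (legB k' s) 1)) j) w := by
    intro w
    rw [hexpA, hexpB, Finset.sum_mul_sum]
    refine Finset.sum_congr rfl fun k _ => Finset.sum_congr rfl fun k' _ => ?_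
    rw [Fintype.prod_sum_type]
    simp only [Sum.elim_inl, Sum.elim_inr, hΨc]
    ring
  have hintP : ∀ k k', Integrable (fun w => ∏ j : Fin 3 ⊕ Fin 3,
      X (Sum.elim (fun s => hat (Pi.single (legA k s) 1)) (fun s => hat (Pi.single (legB k' s) 1)) j) w) μP :=
    fun k k' => integrable_prod hX _ _
  have hintWP : ∀ k k', Integrable (fun w => (X ℓA w * X ℓA w - sA) * (X ℓB w * X ℓB w - sB) *
      ∏ j : Fin 3 ⊕ Fin 3, X (Sum.elim (fun s => hat (Pi.single (legA k s) 1)) (fun s => hat (Pi.single (legB k' s) 1)) j) w) μP := by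
    intro k k'
    have I4 := integrable_mul_mul_mul_mul_prod_of_hint (L := X) (μ := μP) (fun κ s y => integrable_prod hX s y) ℓA ℓA ℓB ℓB
      (Finset.univ : Finset (Fin 3 ⊕ Fin 3)) (Sum.elim (fun s => hat (Pi.single (legA k s) 1)) (fun s => hat (Pi.single (legB k' s) 1)))
    have I2A := integrable_mul_mul_prod_of_hint (L := X) (μ := μP) (fun κ s y => integrable_prod hX s y) ℓA ℓA
      (Finset.univ : Finset (Fin 3 ⊕ Fin 3)) (Sum.elim (fun s => hat (Pi.single (legA k s) 1)) (fun s => hat (Pi.single (legB k' s) 1)))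
    have I2B := integrable_mul_mul_prod_of_hint (L := X) (μ := μP) (fun κ s y => integrable_prod hX s y) ℓB ℓB
      (Finset.univ : Finset (Fin 3 ⊕ Fin 3)) (Sum.elim (fun s => hat (Pi.single (legA k s) 1)) (fun s => hat (Pi.single (legB k' s) 1)))
    have I0 := hintP k k'
    refine (((I4.sub (I2B.const_mul sA)).sub (I2A.const_mul sB)).add (I0.const_mul (sA * sB))).congr (ae_of_all _ fun w => ?_)
    simp only [Pi.add_apply, Pi.sub_apply]
    ring
  have hintW : Integrable (fun w => (X ℓA w * X ℓA w - sA) * (X ℓB w * X ℓB w - sB)) μP := by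
    have I4 := integrable_mul_mul_mul_mul_prod_of_hint (L := X) (μ := μP) (fun κ s y => integrable_prod hX s y) ℓA ℓA ℓB ℓB
      (∅ : Finset Unit) (fun _ => ℓA)
    have I2A := integrable_mul_mul_prod_of_hint (L := X) (μ := μP) (fun κ s y => integrable_prod hX s y) ℓA ℓA (∅ : Finset Unit) (fun _ => ℓA)
    have I2B := integrable_mul_mul_prod_of_hint (L := X) (μ := μP) (fun κ s y => integrable_prod hX s y) ℓB ℓB (∅ : Finset Unit) (fun _ => ℓA)
    refine (((I4.sub (I2B.const_mul sA)).sub (I2A.const_mul sB)).add (integrable_const (sA * sB))).congr (ae_of_all _ fun w => ?_)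
    simp only [Pi.add_apply, Pi.sub_apply, Finset.prod_empty, mul_one]
    ring
  refine ⟨?_, ?_, ?_⟩
  · have hpt : ∀ w, (linCurv H (plaq12At x₀) (Ψ w) c₀ ^ 2 - sA) * (linCurv H (plaq12At xT) (Ψ w) cT ^ 2 - sB) *
        (tripleForm T (plaqVar H x μ ν (Ψ w)) * tripleForm T' (plaqVar H y μ' ν' (Ψ w))) =
        ∑ k, ∑ k', cA k * cB k' * ((X ℓA w * X ℓA w - sA) * (X ℓB w * X ℓB w - sB) *
          ∏ j : Fin 3 ⊕ Fin 3, X (Sum.elim (fun s => hat (Pi.single (legA k s) 1)) (fun s => hat (Pi.single (legB k' s) 1)) j) w) := by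
      intro w
      rw [hW, hV, Finset.mul_sum]
      refine Finset.sum_congr rfl fun k _ => ?_
      rw [Finset.mul_sum]
      exact Finset.sum_congr rfl fun k' _ => by ring
    refine (integrable_finsetSum Finset.univ fun k _ =>
      integrable_finsetSum Finset.univ fun k' _ => (hintWP k k').const_mul (cA k * cB k')).congr (ae_of_all _ fun w => ?_)
    simp only []
    exact (hpt w).symm
  · exact hintW.congr (ae_of_all _ fun w => (hW w).symm)
  · refine (integrable_finsetSum Finset.univ fun k _ =>
      integrable_finsetSum Finset.univ fun k' _ => (hintP k k').const_mul (cA k * cB k')).congr (ae_of_all _ fun w => ?_)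
    simp only []
    exact (hV w).symm
/-! ## §2 The size of the cubic pair -/

/-- Pure algebra: `(Σ_c f)(Σ_{c'} g)(β·Σ_p t)² = β²·Σ_c Σ_{c'} Σ_p Σ_{p'} f_c g_{c'} (t_p t_{p'})`. -/
theorem sum_mul_sum_mul_sq_sum {ι κ : Type*} (s : Finset κ) [Fintype ι] (f g : ι → ℝ) (t : κ → ℝ) (β : ℝ) :
    (∑ c, f c) * (∑ c', g c') * (β * ∑ p ∈ s, t p) ^ 2 = β ^ 2 * ∑ c, ∑ c', ∑ p ∈ s, ∑ p' ∈ s, f c * g c' * (t p * t p') := by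
  calc (∑ c, f c) * (∑ c', g c') * (β * ∑ p ∈ s, t p) ^ 2
      = (∑ c, ∑ c', f c * g c') * (β ^ 2 * ∑ p ∈ s, ∑ p' ∈ s, t p * t p') := by
        rw [Finset.sum_mul_sum, mul_pow, pow_two (∑ p ∈ s, t p), Finset.sum_mul_sum]
    _ = β ^ 2 * ((∑ c, ∑ c', f c * g c') * ∑ p ∈ s, ∑ p' ∈ s, t p * t p') := by ring
    _ = β ^ 2 * ∑ c, ∑ c', ∑ p ∈ s, ∑ p' ∈ s, f c * g c' * (t p * t p') := by
        congr 1
        rw [Finset.sum_mul]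
        refine Finset.sum_congr rfl fun c _ => ?_
        rw [Finset.sum_mul]
        refine Finset.sum_congr rfl fun c' _ => ?_
        rw [Finset.mul_sum]
        refine Finset.sum_congr rfl fun p _ => ?_
        rw [Finset.mul_sum]

/-- Pure algebra: `β²ΣΣΣΣ E₁ − (ΣΣ E₂)·(β²ΣΣ E₃) = β²ΣΣΣΣ (E₁ − E₂E₃)`. -/
theorem cum4_regroup {ι κ : Type*} (s : Finset κ) [Fintype ι] (β : ℝ) (E₁ : ι → ι → κ → κ → ℝ) (E₂ : ι → ι → ℝ) (E₃ : κ → κ → ℝ) :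
    β ^ 2 * (∑ c, ∑ c', ∑ p ∈ s, ∑ p' ∈ s, E₁ c c' p p') - (∑ c, ∑ c', E₂ c c') * (β ^ 2 * ∑ p ∈ s, ∑ p' ∈ s, E₃ p p') =
      β ^ 2 * ∑ c, ∑ c', ∑ p ∈ s, ∑ p' ∈ s, (E₁ c c' p p' - E₂ c c' * E₃ p p') := by
  rw [mul_left_comm, ← mul_sub, Finset.sum_mul, ← Finset.sum_sub_distrib]
  congr 1
  refine Finset.sum_congr rfl fun c _ => ?_
  rw [Finset.sum_mul, ← Finset.sum_sub_distrib]
  refine Finset.sum_congr rfl fun c' _ => ?_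
  rw [Finset.mul_sum, ← Finset.sum_sub_distrib]
  refine Finset.sum_congr rfl fun p _ => ?_
  rw [Finset.mul_sum, ← Finset.sum_sub_distrib]

/-- Pure algebra: the per-pair bound of ✓`abs_connected_linCurvSq_tripleForm_pair_le` with all six propagator bounds of the form `K·g` (`g_{xy} ≤ 1`) is at most
`K⁵·(221184·g_{xy}²·(u + v) + 165888·(u² + v²))`, `u = g_{x0}g_{yT}`, `v = g_{y0}g_{xT}`. -/
theorem pair_bound_le {K gxy u v : ℝ} (hK : 0 ≤ K) (hg1 : gxy ≤ 1) :
    864 * (16 * K) * (K * gxy) ^ 2 * (16 * K ^ 2 * (u + v)) + 324 * (K * gxy) * (16 * K ^ 2 * (u + v)) ^ 2 ≤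
      K ^ 5 * (221184 * gxy ^ 2 * (u + v) + 165888 * (u ^ 2 + v ^ 2)) := by
  have h1 : (u + v) ^ 2 ≤ 2 * (u ^ 2 + v ^ 2) := by nlinarith [sq_nonneg (u - v)]
  have h2 : gxy * (u + v) ^ 2 ≤ 1 * (2 * (u ^ 2 + v ^ 2)) := mul_le_mul hg1 h1 (sq_nonneg _) zero_le_one
  have hK5 : 0 ≤ K ^ 5 := pow_nonneg hK 5
  have h3 : K ^ 5 * (82944 * (gxy * (u + v) ^ 2)) ≤ K ^ 5 * (82944 * (1 * (2 * (u ^ 2 + v ^ 2)))) :=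
    mul_le_mul_of_nonneg_left (mul_le_mul_of_nonneg_left h2 (by norm_num)) hK5
  have heq : 864 * (16 * K) * (K * gxy) ^ 2 * (16 * K ^ 2 * (u + v)) + 324 * (K * gxy) * (16 * K ^ 2 * (u + v)) ^ 2 =
      K ^ 5 * (221184 * gxy ^ 2 * (u + v)) + K ^ 5 * (82944 * (gxy * (u + v) ^ 2)) := by ring
  rw [heq]
  nlinarith

/-- ★★ **`ConnectedFourPoint`, CUBIC PAIR — THE SIZE**: `|E₀[L̃₀L̃_T P²] − E₀[L̃₀L̃_T]E₀[P²]| ≤ C·B²·(1+log H)⁷/β³` (see the module docstring). -/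
theorem abs_cum4_linCurvSq_cubicPair_le : ∃ C : ℝ, 0 ≤ C ∧ ∀ H : ℕ, 1 ≤ H → ∀ β : ℝ, 0 < β → ∀ B : ℝ,
    ∀ Tc : ZdPlaquette 4 → Fin 4 → Fin 4 → Fin 4 → ℝ, (∀ p i j k, |Tc p i j k| ≤ B) → ∀ x₀ xT : Site 4,
    |gaussAvg β H (fun a =>
          (linCurvSq H (plaq12At x₀) a - gaussAvg β H (linCurvSq H (plaq12At x₀))) *
          (linCurvSq H (plaq12At xT) a - gaussAvg β H (linCurvSq H (plaq12At xT))) *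
          (β * ∑ p ∈ plaquettesTouching (boxEdges 4 (2 * H + 1)), tripleForm (Tc p) (plaqVar H p.1 p.2.1.1 p.2.1.2 a)) ^ 2)
      - gaussAvg β H (fun a =>
          (linCurvSq H (plaq12At x₀) a - gaussAvg β H (linCurvSq H (plaq12At x₀))) *
          (linCurvSq H (plaq12At xT) a - gaussAvg β H (linCurvSq H (plaq12At xT)))) *
        gaussAvg β H (fun a =>
          (β * ∑ p ∈ plaquettesTouching (boxEdges 4 (2 * H + 1)), tripleForm (Tc p) (plaqVar H p.1 p.2.1.1 p.2.1.2 a)) ^ 2)| ≤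
      C * B ^ 2 * (1 + Real.log H) ^ 7 / β ^ 3 := by
  obtain ⟨C₉, hC₉0, hcr⟩ := cross_propagator_le
  obtain ⟨Cp, hCp0, hps⟩ := PlaqSums.plaquettePairSums
  refine ⟨9 * 384 ^ 2 * 774144 * 9 ^ 5 / 32 * C₉ ^ 5 * Cp, by positivity, fun H hH β hβ B Tc hT x₀ xT => ?_⟩
  classical
  set PT := plaquettesTouching (boxEdges 4 (2 * H + 1)) with hPT
  set L := 1 + Real.log H with hLdef
  have hL0 : 0 ≤ L := by
    have : (1 : ℝ) ≤ H := by exact_mod_cast hH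
    have := Real.log_nonneg this; rw [hLdef]; linarith
  set K := (2 * β)⁻¹ * (9 * C₉ * L) with hK
  have hK0 : 0 ≤ K := by positivity
  have hB0 : 0 ≤ B := (abs_nonneg _).trans (hT (((0 : Site 4), ⟨(0, 1), by decide⟩) : ZdPlaquette 4) 0 0 0)
  -- distance weights
  have g2nn : ∀ a b : Site 4, 0 ≤ 1 / (1 + siteDist a b) ^ 2 := fun a b => by have := GhostKernel.siteDist_nonneg a b; positivity
  have g2le : ∀ a b : Site 4, 1 / (1 + siteDist a b) ^ 2 ≤ 1 := fun a b => by
    have h1 : (1 : ℝ) ≤ (1 + siteDist a b) ^ 2 := one_le_pow₀ (by linarith [GhostKernel.siteDist_nonneg a b])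
    exact (div_le_one (by positivity)).mpr h1
  have hKform : ∀ a b : Site 4, (2 * β)⁻¹ * (9 * C₉ * (1 + Real.log H) / (1 + siteDist a b) ^ 2) = K * (1 / (1 + siteDist a b) ^ 2) := by
    intro a b; rw [hK, hLdef]; ring
  -- ### the transfer (for linearity only)
  obtain ⟨M, hMdet, htr, hleg, hcov⟩ := gaussAvg_eq_integral_pi H hβ
  set μP : Measure (Fin (Fintype.card (LandauFree H × Fin 3)) → ℝ) :=
    Measure.pi fun _ => gaussianReal 0 (Real.toNNReal (2 * β)⁻¹) with hμP
  obtain ⟨Ψ, hΨdef⟩ : ∃ Ψ : (Fin (Fintype.card (LandauFree H × Fin 3)) → ℝ) → (LandauFree H → E3),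
      Ψ = fun w => (flatten (LandauFree H)).symm fun i => (M⁻¹ *ᵥ w) (Fintype.equivFin (LandauFree H × Fin 3) i) := ⟨_, rfl⟩
  obtain ⟨X, hXdef⟩ : ∃ X : (Fin (Fintype.card (LandauFree H × Fin 3)) → ℝ) → (Fin (Fintype.card (LandauFree H × Fin 3)) → ℝ) → ℝ,
      X = fun ℓ w => ℓ ⬝ᵥ (M⁻¹ *ᵥ w) := ⟨_, rfl⟩
  obtain ⟨hat, hhat⟩ : ∃ hat : (LandauFree H × Fin 3 → ℝ) → (Fin (Fintype.card (LandauFree H × Fin 3)) → ℝ),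
      hat = fun t j => t ((Fintype.equivFin (LandauFree H × Fin 3)).symm j) := ⟨_, rfl⟩
  have hX : IsGaussianProcess X μP := by rw [hXdef]; exact isGaussianProcess_legs M β
  have hPm : IsProbabilityMeasure μP := hX.isProbabilityMeasure
  have htr' : ∀ F : (LandauFree H → E3) → ℝ, gaussAvg β H F = ∫ w, F (Ψ w) ∂μP := fun F => by rw [hΨdef]; exact htr F
  have hleg' : ∀ (t : LandauFree H × Fin 3 → ℝ) w, t ⬝ᵥ flatten (LandauFree H) (Ψ w) = X (hat t) w := fun t w => by
    rw [hΨdef, hXdef, hhat]; exact hleg t w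
  have hΨc : ∀ w (e : LandauFree H) (c : Fin 3), (Ψ w) e c = X (hat (Pi.single (e, c) 1)) w := fun w e c => by
    rw [coord_eq_single_dotProduct_flatten, hleg']
  have hΨA : ∀ w (z : Site 4) (c : Fin 3), linCurv H (plaq12At z) (Ψ w) c =
      X (hat (fun q : LandauFree H × Fin 3 => if q.2 = c then landauCoeff H (plaq12At z) q.1 else 0)) w := fun w z c => by
    rw [linCurv_eq_dotProduct_flatten, hleg']
  have hint2 : ∀ ℓ ℓ', Integrable (fun w => X ℓ w * X ℓ' w) μP := fun ℓ ℓ' =>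
    (hX.hasGaussianLaw_eval ℓ).memLp_two.integrable_mul (hX.hasGaussianLaw_eval ℓ').memLp_two
  -- `E₀[linCurvSq_z] = Σ_c E₀[linCurv_z c ^ 2]`
  have hLsq : ∀ z : Site 4, gaussAvg β H (linCurvSq H (plaq12At z)) = ∑ c, gaussAvg β H (fun a => linCurv H (plaq12At z) a c ^ 2) := by
    intro z
    simp only [htr', linCurvSq]
    rw [integral_finsetSum _ fun c _ =>
      (hint2 (hat (fun q : LandauFree H × Fin 3 => if q.2 = c then landauCoeff H (plaq12At z) q.1 else 0))
        (hat (fun q : LandauFree H × Fin 3 => if q.2 = c then landauCoeff H (plaq12At z) q.1 else 0))).congr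
        (ae_of_all _ fun w => by rw [hΨA, pow_two])]
  rw [hLsq x₀, hLsq xT]
  -- the per-pair estimate, rewritten in the transferred letters
  have hI := fun (c c' : Fin 3) (p p' : ZdPlaquette 4) => integrable_transfer_pairTerm hX Ψ hat hΨc hΨA (Tc p) (Tc p') (hT p) (hT p')
    p.1 p'.1 p.2.1.1 p.2.1.2 p'.2.1.1 p'.2.1.2 x₀ xT c c'
    (∫ w, linCurv H (plaq12At x₀) (Ψ w) c ^ 2 ∂μP) (∫ w, linCurv H (plaq12At xT) (Ψ w) c' ^ 2 ∂μP)
  have hpair : ∀ (c c' : Fin 3) (p p' : ZdPlaquette 4),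
      |(∫ w, (linCurv H (plaq12At x₀) (Ψ w) c ^ 2 - ∫ w, linCurv H (plaq12At x₀) (Ψ w) c ^ 2 ∂μP) *
            (linCurv H (plaq12At xT) (Ψ w) c' ^ 2 - ∫ w, linCurv H (plaq12At xT) (Ψ w) c' ^ 2 ∂μP) *
            (tripleForm (Tc p) (plaqVar H p.1 p.2.1.1 p.2.1.2 (Ψ w)) * tripleForm (Tc p') (plaqVar H p'.1 p'.2.1.1 p'.2.1.2 (Ψ w))) ∂μP)
        - (∫ w, (linCurv H (plaq12At x₀) (Ψ w) c ^ 2 - ∫ w, linCurv H (plaq12At x₀) (Ψ w) c ^ 2 ∂μP) *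
            (linCurv H (plaq12At xT) (Ψ w) c' ^ 2 - ∫ w, linCurv H (plaq12At xT) (Ψ w) c' ^ 2 ∂μP) ∂μP) *
          ∫ w, tripleForm (Tc p) (plaqVar H p.1 p.2.1.1 p.2.1.2 (Ψ w)) * tripleForm (Tc p') (plaqVar H p'.1 p'.2.1.1 p'.2.1.2 (Ψ w)) ∂μP| ≤
      (384 * B) ^ 2 * (K ^ 5 * (221184 * (1 / (1 + siteDist p.1 p'.1) ^ 2) ^ 2 *
          (1 / (1 + siteDist p.1 x₀) ^ 2 * (1 / (1 + siteDist p'.1 xT) ^ 2) + 1 / (1 + siteDist p'.1 x₀) ^ 2 * (1 / (1 + siteDist p.1 xT) ^ 2))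
        + 165888 * ((1 / (1 + siteDist p.1 x₀) ^ 2 * (1 / (1 + siteDist p'.1 xT) ^ 2)) ^ 2
          + (1 / (1 + siteDist p'.1 x₀) ^ 2 * (1 / (1 + siteDist p.1 xT) ^ 2)) ^ 2))) := by
    intro c c' p p'
    have h := abs_connected_linCurvSq_tripleForm_pair_le H hH hβ (Tc p) (Tc p') (hT p) (hT p') x₀ xT p.1 p'.1
      p.2.1.1 p.2.1.2 p'.2.1.1 p'.2.1.2 c c' (m₀ := K) (ax := K * (1 / (1 + siteDist p.1 x₀) ^ 2))
      (ay := K * (1 / (1 + siteDist p'.1 x₀) ^ 2)) (bx := K * (1 / (1 + siteDist p.1 xT) ^ 2)) (by_ := K * (1 / (1 + siteDist p'.1 xT) ^ 2))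
      (Mxy := K * (1 / (1 + siteDist p.1 p'.1) ^ 2)) hK0 (mul_nonneg hK0 (g2nn _ _)) (mul_nonneg hK0 (g2nn _ _)) (mul_nonneg hK0 (g2nn _ _))
      (mul_nonneg hK0 (g2nn _ _)) (mul_nonneg hK0 (g2nn _ _)) ?_ ?_ ?_ ?_ ?_ ?_
    · simp only [htr'] at h
      refine h.trans (mul_le_mul_of_nonneg_left ?_ (sq_nonneg _))
      have hb := pair_bound_le (K := K) (gxy := 1 / (1 + siteDist p.1 p'.1) ^ 2)
        (u := 1 / (1 + siteDist p.1 x₀) ^ 2 * (1 / (1 + siteDist p'.1 xT) ^ 2))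
        (v := 1 / (1 + siteDist p'.1 x₀) ^ 2 * (1 / (1 + siteDist p.1 xT) ^ 2)) hK0 (g2le _ _)
      refine le_trans (le_of_eq ?_) hb
      ring
    · intro e e' i i' he he' cc cc'
      refine (hcr H hH β hβ x₀ xT 1 2 1 2 e e' i i' he he' cc cc').trans ?_
      rw [hKform]
      exact (mul_le_mul_of_nonneg_left (g2le _ _) hK0).trans (le_of_eq (mul_one K))
    · intro e e' i i' he he' cc cc'
      exact (hcr H hH β hβ x₀ p.1 1 2 _ _ e e' i i' he he' cc cc').trans (le_of_eq (hKform _ _))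
    · intro e e' i i' he he' cc cc'
      exact (hcr H hH β hβ x₀ p'.1 1 2 _ _ e e' i i' he he' cc cc').trans (le_of_eq (hKform _ _))
    · intro e e' i i' he he' cc cc'
      exact (hcr H hH β hβ xT p.1 1 2 _ _ e e' i i' he he' cc cc').trans (le_of_eq (hKform _ _))
    · intro e e' i i' he he' cc cc'
      exact (hcr H hH β hβ xT p'.1 1 2 _ _ e e' i i' he he' cc cc').trans (le_of_eq (hKform _ _))
    · intro e e' i i' he he' cc cc'
      have h1 := hcr H hH β hβ p.1 p'.1 _ _ _ _ e e' i i' he he' cc cc'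
      rw [EdgeChartGaussian.siteDist_comm p'.1 p.1] at h1
      exact h1.trans (le_of_eq (hKform _ _))
  -- ### decomposition of the three Gaussian averages
  simp only [htr']
  have hF1 : ∫ w, (linCurvSq H (plaq12At x₀) (Ψ w) - ∑ c, ∫ w, linCurv H (plaq12At x₀) (Ψ w) c ^ 2 ∂μP) *
        (linCurvSq H (plaq12At xT) (Ψ w) - ∑ c, ∫ w, linCurv H (plaq12At xT) (Ψ w) c ^ 2 ∂μP) *
        (β * ∑ p ∈ PT, tripleForm (Tc p) (plaqVar H p.1 p.2.1.1 p.2.1.2 (Ψ w))) ^ 2 ∂μP =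
      β ^ 2 * ∑ c, ∑ c', ∑ p ∈ PT, ∑ p' ∈ PT,
        ∫ w, (linCurv H (plaq12At x₀) (Ψ w) c ^ 2 - ∫ w, linCurv H (plaq12At x₀) (Ψ w) c ^ 2 ∂μP) *
          (linCurv H (plaq12At xT) (Ψ w) c' ^ 2 - ∫ w, linCurv H (plaq12At xT) (Ψ w) c' ^ 2 ∂μP) *
          (tripleForm (Tc p) (plaqVar H p.1 p.2.1.1 p.2.1.2 (Ψ w)) * tripleForm (Tc p') (plaqVar H p'.1 p'.2.1.1 p'.2.1.2 (Ψ w))) ∂μP := by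
    have hpt : ∀ w, (linCurvSq H (plaq12At x₀) (Ψ w) - ∑ c, ∫ w, linCurv H (plaq12At x₀) (Ψ w) c ^ 2 ∂μP) *
        (linCurvSq H (plaq12At xT) (Ψ w) - ∑ c, ∫ w, linCurv H (plaq12At xT) (Ψ w) c ^ 2 ∂μP) *
        (β * ∑ p ∈ PT, tripleForm (Tc p) (plaqVar H p.1 p.2.1.1 p.2.1.2 (Ψ w))) ^ 2 =
        β ^ 2 * ∑ c, ∑ c', ∑ p ∈ PT, ∑ p' ∈ PT,
          (linCurv H (plaq12At x₀) (Ψ w) c ^ 2 - ∫ w, linCurv H (plaq12At x₀) (Ψ w) c ^ 2 ∂μP) *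
          (linCurv H (plaq12At xT) (Ψ w) c' ^ 2 - ∫ w, linCurv H (plaq12At xT) (Ψ w) c' ^ 2 ∂μP) *
          (tripleForm (Tc p) (plaqVar H p.1 p.2.1.1 p.2.1.2 (Ψ w)) * tripleForm (Tc p') (plaqVar H p'.1 p'.2.1.1 p'.2.1.2 (Ψ w))) := by
      intro w
      simp only [linCurvSq]
      rw [← Finset.sum_sub_distrib, ← Finset.sum_sub_distrib]
      exact sum_mul_sum_mul_sq_sum PT _ _ _ β
    rw [integral_congr_ae (ae_of_all _ hpt), integral_const_mul]
    congr 1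
    rw [integral_finsetSum _ fun c _ => integrable_finsetSum _ fun c' _ =>
      integrable_finsetSum _ fun p _ => integrable_finsetSum _ fun p' _ => (hI c c' p p').1]
    refine Finset.sum_congr rfl fun c _ => ?_
    rw [integral_finsetSum _ fun c' _ => integrable_finsetSum _ fun p _ => integrable_finsetSum _ fun p' _ => (hI c c' p p').1]
    refine Finset.sum_congr rfl fun c' _ => ?_
    rw [integral_finsetSum _ fun p _ => integrable_finsetSum _ fun p' _ => (hI c c' p p').1]
    refine Finset.sum_congr rfl fun p _ => ?_
    rw [integral_finsetSum _ fun p' _ => (hI c c' p p').1]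
  have hF2 : ∫ w, (linCurvSq H (plaq12At x₀) (Ψ w) - ∑ c, ∫ w, linCurv H (plaq12At x₀) (Ψ w) c ^ 2 ∂μP) *
        (linCurvSq H (plaq12At xT) (Ψ w) - ∑ c, ∫ w, linCurv H (plaq12At xT) (Ψ w) c ^ 2 ∂μP) ∂μP =
      ∑ c, ∑ c', ∫ w, (linCurv H (plaq12At x₀) (Ψ w) c ^ 2 - ∫ w, linCurv H (plaq12At x₀) (Ψ w) c ^ 2 ∂μP) *
          (linCurv H (plaq12At xT) (Ψ w) c' ^ 2 - ∫ w, linCurv H (plaq12At xT) (Ψ w) c' ^ 2 ∂μP) ∂μP := by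
    have hpt : ∀ w, (linCurvSq H (plaq12At x₀) (Ψ w) - ∑ c, ∫ w, linCurv H (plaq12At x₀) (Ψ w) c ^ 2 ∂μP) *
        (linCurvSq H (plaq12At xT) (Ψ w) - ∑ c, ∫ w, linCurv H (plaq12At xT) (Ψ w) c ^ 2 ∂μP) =
        ∑ c, ∑ c', (linCurv H (plaq12At x₀) (Ψ w) c ^ 2 - ∫ w, linCurv H (plaq12At x₀) (Ψ w) c ^ 2 ∂μP) *
          (linCurv H (plaq12At xT) (Ψ w) c' ^ 2 - ∫ w, linCurv H (plaq12At xT) (Ψ w) c' ^ 2 ∂μP) := by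
      intro w
      simp only [linCurvSq]
      rw [← Finset.sum_sub_distrib, ← Finset.sum_sub_distrib, Finset.sum_mul_sum]
    have p₀ : ZdPlaquette 4 := ((0 : Site 4), ⟨(0, 1), by decide⟩)
    rw [integral_congr_ae (ae_of_all _ hpt), integral_finsetSum _ fun c _ => integrable_finsetSum _ fun c' _ => (hI c c' p₀ p₀).2.1]
    exact Finset.sum_congr rfl fun c _ => integral_finsetSum _ fun c' _ => (hI c c' p₀ p₀).2.1
  have hF3 : ∫ w, (β * ∑ p ∈ PT, tripleForm (Tc p) (plaqVar H p.1 p.2.1.1 p.2.1.2 (Ψ w))) ^ 2 ∂μP =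
      β ^ 2 * ∑ p ∈ PT, ∑ p' ∈ PT,
        ∫ w, tripleForm (Tc p) (plaqVar H p.1 p.2.1.1 p.2.1.2 (Ψ w)) * tripleForm (Tc p') (plaqVar H p'.1 p'.2.1.1 p'.2.1.2 (Ψ w)) ∂μP := by
    have hpt : ∀ w, (β * ∑ p ∈ PT, tripleForm (Tc p) (plaqVar H p.1 p.2.1.1 p.2.1.2 (Ψ w))) ^ 2 =
        β ^ 2 * ∑ p ∈ PT, ∑ p' ∈ PT,
          tripleForm (Tc p) (plaqVar H p.1 p.2.1.1 p.2.1.2 (Ψ w)) * tripleForm (Tc p') (plaqVar H p'.1 p'.2.1.1 p'.2.1.2 (Ψ w)) := by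
      intro w; rw [mul_pow, pow_two (∑ p ∈ PT, _), Finset.sum_mul_sum]
    rw [integral_congr_ae (ae_of_all _ hpt), integral_const_mul]
    congr 1
    rw [integral_finsetSum _ fun p _ => integrable_finsetSum _ fun p' _ => (hI 0 0 p p').2.2]
    exact Finset.sum_congr rfl fun p _ => integral_finsetSum _ fun p' _ => (hI 0 0 p p').2.2
  rw [hF1, hF2, hF3, cum4_regroup]
  -- ### sum the per-pair bounds
  obtain ⟨h1, h2, h3, h4⟩ := hps H hH x₀ xT
  have hsq : ∀ t : ℝ, (1 / (1 + t) ^ 2) ^ 2 = 1 / (1 + t) ^ 4 := fun t => by rw [div_pow, one_pow, ← pow_mul]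
  have hΦsum : ∑ p ∈ PT, ∑ p' ∈ PT, (221184 * (1 / (1 + siteDist p.1 p'.1) ^ 2) ^ 2 *
          (1 / (1 + siteDist p.1 x₀) ^ 2 * (1 / (1 + siteDist p'.1 xT) ^ 2) + 1 / (1 + siteDist p'.1 x₀) ^ 2 * (1 / (1 + siteDist p.1 xT) ^ 2))
        + 165888 * ((1 / (1 + siteDist p.1 x₀) ^ 2 * (1 / (1 + siteDist p'.1 xT) ^ 2)) ^ 2
          + (1 / (1 + siteDist p'.1 x₀) ^ 2 * (1 / (1 + siteDist p.1 xT) ^ 2)) ^ 2)) ≤ 774144 * Cp * L ^ 2 := by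
    have hre : ∀ p p' : ZdPlaquette 4, 221184 * (1 / (1 + siteDist p.1 p'.1) ^ 2) ^ 2 *
          (1 / (1 + siteDist p.1 x₀) ^ 2 * (1 / (1 + siteDist p'.1 xT) ^ 2) + 1 / (1 + siteDist p'.1 x₀) ^ 2 * (1 / (1 + siteDist p.1 xT) ^ 2))
        + 165888 * ((1 / (1 + siteDist p.1 x₀) ^ 2 * (1 / (1 + siteDist p'.1 xT) ^ 2)) ^ 2
          + (1 / (1 + siteDist p'.1 x₀) ^ 2 * (1 / (1 + siteDist p.1 xT) ^ 2)) ^ 2) =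
        221184 * (1 / (1 + siteDist p.1 p'.1) ^ 4 * (1 / (1 + siteDist p.1 x₀) ^ 2) * (1 / (1 + siteDist p'.1 xT) ^ 2))
        + 221184 * (1 / (1 + siteDist p.1 p'.1) ^ 4 * (1 / (1 + siteDist p'.1 x₀) ^ 2) * (1 / (1 + siteDist p.1 xT) ^ 2))
        + 165888 * (1 / (1 + siteDist p.1 x₀) ^ 4 * (1 / (1 + siteDist p'.1 xT) ^ 4))
        + 165888 * (1 / (1 + siteDist p'.1 x₀) ^ 4 * (1 / (1 + siteDist p.1 xT) ^ 4)) := by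
      intro p p'
      rw [mul_pow, mul_pow, hsq, hsq, hsq, hsq, hsq]
      ring
    simp_rw [hre, Finset.sum_add_distrib]
    have h1' := mul_le_mul_of_nonneg_left h1 (by norm_num : (0 : ℝ) ≤ 221184)
    have h2' := mul_le_mul_of_nonneg_left h2 (by norm_num : (0 : ℝ) ≤ 221184)
    have h3' := mul_le_mul_of_nonneg_left h3 (by norm_num : (0 : ℝ) ≤ 165888)
    have h4' := mul_le_mul_of_nonneg_left h4 (by norm_num : (0 : ℝ) ≤ 165888)
    rw [Finset.mul_sum] at h1' h2' h3' h4'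
    simp_rw [Finset.mul_sum] at h1' h2' h3' h4'
    rw [hLdef]
    linarith [h1', h2', h3', h4']
  have heq9 : (∑ c : Fin 3, ∑ c' : Fin 3, ∑ p ∈ PT, ∑ p' ∈ PT, (384 * B) ^ 2 * (K ^ 5 * (221184 * (1 / (1 + siteDist p.1 p'.1) ^ 2) ^ 2 *
          (1 / (1 + siteDist p.1 x₀) ^ 2 * (1 / (1 + siteDist p'.1 xT) ^ 2) + 1 / (1 + siteDist p'.1 x₀) ^ 2 * (1 / (1 + siteDist p.1 xT) ^ 2))
        + 165888 * ((1 / (1 + siteDist p.1 x₀) ^ 2 * (1 / (1 + siteDist p'.1 xT) ^ 2)) ^ 2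
          + (1 / (1 + siteDist p'.1 x₀) ^ 2 * (1 / (1 + siteDist p.1 xT) ^ 2)) ^ 2)))) =
      9 * ((384 * B) ^ 2 * (K ^ 5 * ∑ p ∈ PT, ∑ p' ∈ PT, (221184 * (1 / (1 + siteDist p.1 p'.1) ^ 2) ^ 2 *
          (1 / (1 + siteDist p.1 x₀) ^ 2 * (1 / (1 + siteDist p'.1 xT) ^ 2) + 1 / (1 + siteDist p'.1 x₀) ^ 2 * (1 / (1 + siteDist p.1 xT) ^ 2))
        + 165888 * ((1 / (1 + siteDist p.1 x₀) ^ 2 * (1 / (1 + siteDist p'.1 xT) ^ 2)) ^ 2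
          + (1 / (1 + siteDist p'.1 x₀) ^ 2 * (1 / (1 + siteDist p.1 xT) ^ 2)) ^ 2)))) := by
    rw [Finset.sum_const, Finset.card_univ, Fintype.card_fin, Finset.sum_const, Finset.card_univ, Fintype.card_fin, smul_smul,
      nsmul_eq_mul]
    simp only [Finset.mul_sum]
    refine Finset.sum_congr rfl fun p _ => Finset.sum_congr rfl fun p' _ => ?_
    push_cast
    ring
  have htot : (∑ c : Fin 3, ∑ c' : Fin 3, ∑ p ∈ PT, ∑ p' ∈ PT, (384 * B) ^ 2 * (K ^ 5 * (221184 * (1 / (1 + siteDist p.1 p'.1) ^ 2) ^ 2 *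
          (1 / (1 + siteDist p.1 x₀) ^ 2 * (1 / (1 + siteDist p'.1 xT) ^ 2) + 1 / (1 + siteDist p'.1 x₀) ^ 2 * (1 / (1 + siteDist p.1 xT) ^ 2))
        + 165888 * ((1 / (1 + siteDist p.1 x₀) ^ 2 * (1 / (1 + siteDist p'.1 xT) ^ 2)) ^ 2
          + (1 / (1 + siteDist p'.1 x₀) ^ 2 * (1 / (1 + siteDist p.1 xT) ^ 2)) ^ 2)))) ≤
      9 * ((384 * B) ^ 2 * (K ^ 5 * (774144 * Cp * L ^ 2))) := by
    rw [heq9]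
    exact mul_le_mul_of_nonneg_left (mul_le_mul_of_nonneg_left (mul_le_mul_of_nonneg_left hΦsum (pow_nonneg hK0 5)) (sq_nonneg _))
      (by norm_num)
  calc _ ≤ β ^ 2 * ∑ c, ∑ c', ∑ p ∈ PT, ∑ p' ∈ PT, (384 * B) ^ 2 * (K ^ 5 * (221184 * (1 / (1 + siteDist p.1 p'.1) ^ 2) ^ 2 *
          (1 / (1 + siteDist p.1 x₀) ^ 2 * (1 / (1 + siteDist p'.1 xT) ^ 2) + 1 / (1 + siteDist p'.1 x₀) ^ 2 * (1 / (1 + siteDist p.1 xT) ^ 2))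
        + 165888 * ((1 / (1 + siteDist p.1 x₀) ^ 2 * (1 / (1 + siteDist p'.1 xT) ^ 2)) ^ 2
          + (1 / (1 + siteDist p'.1 x₀) ^ 2 * (1 / (1 + siteDist p.1 xT) ^ 2)) ^ 2))) := by
        rw [abs_mul, abs_of_nonneg (sq_nonneg β)]
        refine mul_le_mul_of_nonneg_left ?_ (sq_nonneg β)
        refine (Finset.abs_sum_le_sum_abs _ _).trans (Finset.sum_le_sum fun c _ => ?_)
        refine (Finset.abs_sum_le_sum_abs _ _).trans (Finset.sum_le_sum fun c' _ => ?_)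
        refine (Finset.abs_sum_le_sum_abs _ _).trans (Finset.sum_le_sum fun p _ => ?_)
        exact (Finset.abs_sum_le_sum_abs _ _).trans (Finset.sum_le_sum fun p' _ => hpair c c' p p')
    _ ≤ β ^ 2 * (9 * ((384 * B) ^ 2 * (K ^ 5 * (774144 * Cp * L ^ 2)))) := mul_le_mul_of_nonneg_left htot (sq_nonneg β)
    _ = 9 * 384 ^ 2 * 774144 * 9 ^ 5 / 32 * C₉ ^ 5 * Cp * B ^ 2 * (1 + Real.log ↑H) ^ 7 / β ^ 3 := by
        rw [hK, hLdef]
        field_simp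
        ring

end EdgeChartGaussian

end Summit.QuantumFields.YangMills.Theorems.AllWindowsColdBoxBoxHighLine

end
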